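import Literature.NumberTheory.LFunctions.KMVMomentsToHalfEdge
import HarnessLib

/-!
# The printed ½ at prime level, weight 2, as a kernel consequence of the typed
# Kowalski–Michel–VanderKam moment facts (the record at the third knife edge)

Topic `Literature/NumberTheory/LFunctions` (namespace
`Literature.NumberTheory.LFunctions.CentralValueFamilyHalfEdge`). PROVED, 0 named facts (D-0026).
Cell `landau-siegel`, rung F-S3, §C typer pool (lit-typer-4) for §D edge fam / the PrimeLevelFamEdge
birth: the BASELINE twin of `primeLevelFamilyTwo_EStarFam_of_momentAsymptotics` (Bfam-typer-2,
`KMVMomentsToHalfEdge`), which converts mollified moments with Cauchy–Schwarz value `> ¼` into the EDGE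
`∃ p₁ > ½, primeLevelFamilyTwo.EStarFam p₁ 2`. Here the SAME conversion is run at an arbitrary value
`R`: moments with value `R` give `primeLevelFamilyTwo.EStarFam p 2` for every `p < 2R`
(`primeLevelFamilyTwo_EStarFam_of_momentAsymptotics_lt`), and the typed IN-PRINT facts
`kmv2000_firstMomentPQ` / `kmv2000_secondMomentPQ` (Kowalski–Michel–VanderKam 2000, Props. 4.1/5.1,
`Δ < 1`) with the profile `P = Y²` (`KMV2000.ratio_one_X_sq`: value `Δ/(2(1+Δ))`) give the printed
record: `primeLevelFamilyTwo.EStarFam p 2` for EVERY `p < ½` (`primeLevelFamilyTwo_EStarFam_of_kmv_lt_half`)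
— a harmonic proportion `≥ p` of the even weight-2 newforms of every large prime level has
`L(½,f) ≥ (log q)⁻²`, GIVEN those two facts, Kowalski–Michel's Petersson fact and the Lapid–Rallis
non-negativity fact (four displayed fact hypotheses, none asserted; the mollifier norm is a theorem from
the Petersson fact, `KMV2000.mollifierNormBound_of_petersson`); and the paper's printed headline in its
own (harmonic, Thm. 1.6) currency, `harmonicNonvanishing_ge_of_kmv_lt_quarter`: for every `t < ¼` and
all large primes `q`, `Σʰ_{f ∈ H₂(q), L(½,f) ≠ 0} ω_f ≥ t` («p₀ ≥ 1/4», p. 2). The edge is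
`p > ½` («Fifty percent is not enough!»): the same machine reaches every `p < ½` and stops there
(`KMV2000.ratio_one_lt_quarter`, `Δ < 1`).

«The programme SEARCHES and TYPES; no claim about Landau–Siegel zeros, Theorems 1–2 of
arXiv:2211.02515 or a repaired Margin232 until a kernel theorem says so.»

## References

* [KowalskiMichelVanderKam2000] E. Kowalski, P. Michel, J. VanderKam, *Non-vanishing of high
  derivatives of automorphic L-functions at the center of the critical strip*, J. reine angew. Math.
  526 (2000): p. 2 after Thm. 1.1 («The currently best bounds for these constants are p₀ ≥ 1/4 and
  p₁ ≥ 7/16»), Thm. 1.6 (harmonic weights, `Σʰ_{S₂^±} 1 ∼ ½`), p. 7 footnote 2 and §6 (35) («P₀(x) = x² …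
  leads to the p₀ = 1/4», `Δ → 1`), Props. 4.1/5.1 (the moments, `0 < Δ < 1`), Thm. 6.1 (32)
  (held: paper:doi-10-1515-crll-2000-074, pages p0002/p0004/p0007/p0021).
* [IwaniecConversations2006] H. Iwaniec, LNM 1891 (2006), §7 (7.5), p0097 («Fifty percent is not
  enough!»).
-/

noncomputable section

namespace Literature.NumberTheory.LFunctions.CentralValueFamilyHalfEdge

open Filter Topology Polynomial
open Literature.NumberTheory.EllipticCurves.ModularForms
open Literature.NumberTheory.LFunctions.IwaniecSarnak

/-- **Mollified moments with Cauchy–Schwarz value `R` ⇒ `primeLevelFamilyTwo.EStarFam p 2` for every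
`p < 2R`** (the conversion of `primeLevelFamilyTwo_EStarFam_of_momentAsymptotics` at an arbitrary
value: «`R` of all forms» = «`2R` of the even ones», the even harmonic mass being `½ + o(1)` by the
Petersson fact). Same displayed hypotheses: the moment asymptotics on a window containing `Δ`, an
admissible profile `P`, KMV's side condition `q̂^Δ ∉ ℕ`, the mollifier-norm shape, `c₁ ≠ 0`, `c₂ > 0`.
[cite: KowalskiMichelVanderKam2000, Thm. 6.1 (32) and §6 p. 19] [cite: IwaniecConversations2006, §7 (7.5)] -/
theorem primeLevelFamilyTwo_EStarFam_of_momentAsymptotics_lt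
    (hP : KowalskiMichel2000.kowalskiMichel2000_petersson)
    (hLR : lapidRallis2003_theorem1_gl2Twist)
    {Δlo Δhi : ℝ} {T₁ T₂ : ℝ → ℝ[X] → ℝ[X] → ℝ} (hMA : KMV2000.MomentAsymptotics Δlo Δhi T₁ T₂)
    {P : ℝ[X]} (hPadm : KMV2000.Admissible P) {Δ : ℝ} (hΔ : 0 < Δ) (hlo : Δlo < Δ)
    (hhi : Δ ≤ Δhi)
    (hgen : ∃ q₁ : ℕ, ∀ q : ℕ, q.Prime → q₁ ≤ q → ∀ n : ℕ, (n : ℝ) ≠ KMV2000.qhat q ^ Δ)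
    (hnorm : ∃ C : ℝ, ∃ q₁ : ℕ, ∀ (q : ℕ) [NeZero q], q.Prime → q₁ ≤ q →
      harmonicSum q 2 (fun f ↦ ‖KMV2000.mollifierP q P (KMV2000.qhat q ^ Δ) f‖ ^ 2) ≤
        C * Real.log (KMV2000.qhat q))
    (hc₁ : KMV2000.linForm Δ P 1 + T₁ Δ P 1 ≠ 0)
    (hc₂ : 0 < KMV2000.secondMomentForm Δ P 1 + T₂ Δ P 1)
    {p : ℝ} (hp : p < 2 * ((KMV2000.linForm Δ P 1 + T₁ Δ P 1) ^ 2 /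
      (2 * (KMV2000.secondMomentForm Δ P 1 + T₂ Δ P 1)))) :
    primeLevelFamilyTwo.EStarFam p 2 := by
  set c₁ : ℝ := KMV2000.linForm Δ P 1 + T₁ Δ P 1 with hc₁_def
  set c₂ : ℝ := KMV2000.secondMomentForm Δ P 1 + T₂ Δ P 1 with hc₂_def
  set R : ℝ := c₁ ^ 2 / (2 * c₂) with hR_def
  have hRpos : 0 < R := div_pos (by positivity) (by positivity)
  by_cases hp0 : p ≤ 0
  · -- a non-positive proportion is free
    refine ⟨0, fun N _ _ => ?_⟩
    have hnn := primeLevelFamilyTwo_nonnegOn hLR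
    have hW : 0 ≤ primeLevelFamilyTwo.evenMass N := primeLevelFamilyTwo.evenMass_nonneg hnn N
    have hG : 0 ≤ primeLevelFamilyTwo.goodMass 2 N :=
      Finset.sum_nonneg fun f hf => by
        classical
        exact (hnn N f (Finset.mem_filter.1 (Finset.mem_filter.1 hf).1).1).1
    nlinarith
  push Not at hp0
  -- slack: `p (½ + ε) ≤ R − ε`
  set ε : ℝ := min (1 / 2) ((2 * R - p) / (2 * (1 + p))) with hε_def
  have hε : 0 < ε := lt_min (by norm_num) (div_pos (by linarith) (by linarith))
  have hε1 : ε ≤ 1 / 2 := min_le_left _ _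
  have hεR : ε ≤ (2 * R - p) / (2 * (1 + p)) := min_le_right _ _
  have hkey : p * (1 / 2 + ε) ≤ R - ε := by
    have h := (le_div_iff₀ (by linarith : (0 : ℝ) < 2 * (1 + p))).1 hεR
    nlinarith
  obtain ⟨q₀, Hgood⟩ := KMV2000.goodMass_lower_of_momentAsymptotics hLR hMA hPadm hΔ hlo hhi hgen
    hnorm hc₁ hc₂ hε
  obtain ⟨Ct, Ht⟩ := abs_totalMass_sub_one_le hP
  obtain ⟨Ce, He⟩ := abs_two_mul_evenMass_sub_totalMass_le hP
  -- the Petersson error terms are eventually `< ε`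
  have hev : ∀ᶠ q : ℕ in atTop,
      Ct * (q : ℝ) ^ (-(3 / 2 : ℝ)) < ε ∧ Ce * (q : ℝ) ^ (-(1 / 4 : ℝ)) < ε := by
    have h1 : Tendsto (fun q : ℕ ↦ Ct * (q : ℝ) ^ (-(3 / 2 : ℝ))) atTop (𝓝 0) := by
      have h := ((tendsto_rpow_neg_atTop (by norm_num : (0 : ℝ) < 3 / 2)).comp
        tendsto_natCast_atTop_atTop).const_mul Ct
      rw [mul_zero] at h
      exact h
    have h2 : Tendsto (fun q : ℕ ↦ Ce * (q : ℝ) ^ (-(1 / 4 : ℝ))) atTop (𝓝 0) := by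
      have h := ((tendsto_rpow_neg_atTop (by norm_num : (0 : ℝ) < 1 / 4)).comp
        tendsto_natCast_atTop_atTop).const_mul Ce
      rw [mul_zero] at h
      exact h
    exact ((tendsto_order.1 h1).2 ε hε).and ((tendsto_order.1 h2).2 ε hε)
  obtain ⟨q₃, Hq₃⟩ := Filter.eventually_atTop.1 hev
  refine ⟨((max q₀ q₃ : ℕ) : ℝ), fun (N : ℕ+) (hadm : Squarefree (N : ℕ) ∧ (N : ℕ).Prime)
      (hsz : ((max q₀ q₃ : ℕ) : ℝ) ≤ ((N : ℕ) : ℝ)) ↦ ?_⟩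
  have hN : max q₀ q₃ ≤ (N : ℕ) := by exact_mod_cast hsz
  have hNq₀ : q₀ ≤ (N : ℕ) := le_trans (le_max_left _ _) hN
  have hNq₃ : q₃ ≤ (N : ℕ) := le_trans (le_max_right _ _) hN
  obtain ⟨hW1, hE1⟩ := Hq₃ (N : ℕ) hNq₃
  have hprime : (N : ℕ).Prime := hadm.2
  have hWabs := Ht (N : ℕ) hprime
  have hEabs := He (N : ℕ) hprime
  have hW2 : harmonicSum (N : ℕ) 2 (fun _ ↦ (1 : ℝ)) ≤ 2 := by
    have := (abs_le.1 hWabs).2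
    linarith
  have hE : harmonicSum (N : ℕ) 2 (fun f ↦ if rootNumber f = 1 then (1 : ℝ) else 0) ≤
      1 / 2 + ε := by
    have h₁ := (abs_le.1 hEabs).2
    have h₂ := (abs_le.1 hWabs).2
    linarith
  have hgood := Hgood (N : ℕ) hprime hNq₀ hW2
  show p * (iwaniecSarnakFamily 2).evenMass N ≤ (iwaniecSarnakFamily 2).goodMass 2 N
  rw [evenMass_iwaniecSarnakFamily, goodMass_iwaniecSarnakFamily]
  calc p * harmonicSum (N : ℕ) 2 (fun f ↦ if rootNumber f = 1 then (1 : ℝ) else 0)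
      ≤ p * (1 / 2 + ε) := mul_le_mul_of_nonneg_left hE hp0.le
    _ ≤ R - ε := hkey
    _ ≤ _ := hgood

/-- **THE PRINTED ½ AT PRIME LEVEL, WEIGHT 2, FROM THE TYPED MOMENT FACTS.** Kowalski–Michel–VanderKam's
first/second mollified harmonic moment asymptotics for `0 < Δ < 1` (`kmv2000_firstMomentPQ`,
`kmv2000_secondMomentPQ` — theorems in print, typed as named facts), Kowalski–Michel's Petersson fact,
and the Lapid–Rallis non-negativity fact imply `primeLevelFamilyTwo.EStarFam p 2` for EVERY `p < ½`
(the mollifier norm `Σʰ|M_P|² ≪ log q̂` being a theorem from the Petersson fact,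
`KMV2000.mollifierNormBound_of_petersson`, Bfam-typer-2 p484308), with the profile `P = Y²`: the profile `Y²` has Cauchy–Schwarz value
`Δ/(2(1+Δ))` (`KMV2000.ratio_one_X_sq`), i.e. `Δ/(1+Δ) ↑ ½` of the even mass as `Δ ↑ 1`; a generic
`Δ` below `1` supplies KMV's side condition `q̂^Δ ∉ ℕ` (`KMV2000.exists_mem_Ioo_qhat_rpow_ne_nat`).
This is the record of record at the third knife edge as a kernel implication (the edge asks `p > ½`);
nothing here asserts the four facts.
[cite: KowalskiMichelVanderKam2000, p. 2 after Thm. 1.1 («p₀ ≥ 1/4»), Thm. 1.6, p. 7 footnote 2 and §6 (35) (P₀ = x², Δ → 1), Props. 4.1/5.1] [cite: IwaniecConversations2006, §7 (7.5) and p0097 («Fifty percent is not enough!»)] -/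
theorem primeLevelFamilyTwo_EStarFam_of_kmv_lt_half
    (h₁ : kmv2000_firstMomentPQ) (h₂ : kmv2000_secondMomentPQ)
    (hP : KowalskiMichel2000.kowalskiMichel2000_petersson)
    (hLR : lapidRallis2003_theorem1_gl2Twist)
    {p : ℝ} (hp : p < 1 / 2) : primeLevelFamilyTwo.EStarFam p 2 := by
  -- a length exponent `Δ ∈ (a, 1)` with `Δ/(1+Δ) > p`, generic for the side condition
  set t : ℝ := max p 0 with ht_def
  have ht0 : 0 ≤ t := le_max_right _ _
  have ht1 : t < 1 / 2 := max_lt hp (by norm_num)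
  have hpt : p ≤ t := le_max_left _ _
  set a : ℝ := t / (1 - t) with ha_def
  have ha0 : 0 ≤ a := div_nonneg ht0 (by linarith)
  have ha1 : a < 1 := by rw [ha_def, div_lt_one (by linarith)]; linarith
  obtain ⟨Δ, ⟨haΔ, hΔ1⟩, hgenΔ⟩ := KMV2000.exists_mem_Ioo_qhat_rpow_ne_nat ha1
  have hΔ0 : 0 < Δ := lt_of_le_of_lt ha0 haΔ
  -- the printed asymptotics on the window `(a, Δ]`
  have hMA : KMV2000.MomentAsymptotics a Δ (fun _ _ _ ↦ 0) (fun _ _ _ ↦ 0) :=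
    KMV2000.momentAsymptoticsDiagOnly_of_kmv h₁ h₂ ha0 hΔ1
  -- the profile `Y²`: `c₁ = 2`, `c₂ > 0`, value `Δ/(2(1+Δ))`
  have hc₁ : KMV2000.linForm Δ (X ^ 2) 1 + (fun _ _ _ ↦ (0 : ℝ)) Δ (X ^ 2 : ℝ[X]) (1 : ℝ[X]) ≠ 0 := by
    rw [KMV2000.linForm_one]
    simp
  have hratio := KMV2000.ratio_one_X_sq hΔ0
  have hsec_nn : 0 ≤ KMV2000.secondMomentForm Δ (X ^ 2) 1 := KMV2000.secondMomentForm_nonneg hΔ0.le _ _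
  have henv : 0 < KMV2000.envelope Δ := by
    unfold KMV2000.envelope; positivity
  have hsec : 0 < KMV2000.secondMomentForm Δ (X ^ 2) 1 := by
    rcases hsec_nn.eq_or_lt with h | h
    · exfalso
      unfold KMV2000.ratio at hratio
      rw [← h, mul_zero, div_zero] at hratio
      exact henv.ne hratio
    · exact h
  have hc₂ : 0 < KMV2000.secondMomentForm Δ (X ^ 2) 1 + (fun _ _ _ ↦ (0 : ℝ)) Δ (X ^ 2 : ℝ[X]) (1 : ℝ[X]) := by
    simpa using hsec
  have hgen : ∃ q₁ : ℕ, ∀ q : ℕ, q.Prime → q₁ ≤ q → ∀ n : ℕ, (n : ℝ) ≠ KMV2000.qhat q ^ Δ :=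
    ⟨40, fun q _ hq n ↦ hgenΔ q hq n⟩
  refine primeLevelFamilyTwo_EStarFam_of_momentAsymptotics_lt hP hLR hMA KMV2000.admissible_X_sq hΔ0
    haΔ le_rfl hgen (KMV2000.mollifierNormBound_of_petersson hP (X ^ 2) hΔ0 (by linarith)) hc₁ hc₂ ?_
  -- `p < 2 · value = Δ/(1+Δ)`
  have hval : 2 * ((KMV2000.linForm Δ (X ^ 2) 1 + (fun _ _ _ ↦ (0 : ℝ)) Δ (X ^ 2 : ℝ[X]) (1 : ℝ[X])) ^ 2 /
      (2 * (KMV2000.secondMomentForm Δ (X ^ 2) 1 + (fun _ _ _ ↦ (0 : ℝ)) Δ (X ^ 2 : ℝ[X]) (1 : ℝ[X])))) =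
      Δ / (1 + Δ) := by
    have e : (KMV2000.linForm Δ (X ^ 2) 1 + (fun _ _ _ ↦ (0 : ℝ)) Δ (X ^ 2 : ℝ[X]) (1 : ℝ[X])) ^ 2 /
        (2 * (KMV2000.secondMomentForm Δ (X ^ 2) 1 + (fun _ _ _ ↦ (0 : ℝ)) Δ (X ^ 2 : ℝ[X]) (1 : ℝ[X]))) =
        KMV2000.ratio Δ (X ^ 2) 1 := by
      simp [KMV2000.ratio]
    rw [e, hratio, KMV2000.envelope]
    field_simp
  rw [hval]
  -- `t/(1-t) < Δ` gives `t < Δ/(1+Δ)`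
  have h1t : 0 < 1 - t := by linarith
  have hlt : t < Δ / (1 + Δ) := by
    rw [lt_div_iff₀ (by linarith)]
    have := (div_lt_iff₀ h1t).1 haΔ
    nlinarith
  linarith

/-- The Petersson error terms are eventually small: for every `ε > 0` and all large primes `q`,
`Σʰ_{H₂(q)} 1 ≤ 2` and `½ − ε ≤ Σʰ_{w_f = 1} 1` (from `abs_totalMass_sub_one_le`,
`abs_two_mul_evenMass_sub_totalMass_le`). [folklore] -/
private theorem evenMass_ge_eventually (hP : KowalskiMichel2000.kowalskiMichel2000_petersson)
    {ε : ℝ} (hε : 0 < ε) :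
    ∃ q₃ : ℕ, ∀ (q : ℕ) [NeZero q], q.Prime → q₃ ≤ q →
      harmonicSum q 2 (fun _ ↦ (1 : ℝ)) ≤ 2 ∧
        1 / 2 - ε ≤ harmonicSum q 2 (fun f ↦ if rootNumber f = 1 then (1 : ℝ) else 0) := by
  obtain ⟨Ct, Ht⟩ := abs_totalMass_sub_one_le hP
  obtain ⟨Ce, He⟩ := abs_two_mul_evenMass_sub_totalMass_le hP
  set ε' : ℝ := min ε 1 with hε'_def
  have hε' : 0 < ε' := lt_min hε one_pos
  have hε'ε : ε' ≤ ε := min_le_left _ _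
  have hε'1 : ε' ≤ 1 := min_le_right _ _
  have hev : ∀ᶠ q : ℕ in atTop,
      Ct * (q : ℝ) ^ (-(3 / 2 : ℝ)) < ε' ∧ Ce * (q : ℝ) ^ (-(1 / 4 : ℝ)) < ε' := by
    have h1 : Tendsto (fun q : ℕ ↦ Ct * (q : ℝ) ^ (-(3 / 2 : ℝ))) atTop (𝓝 0) := by
      have h := ((tendsto_rpow_neg_atTop (by norm_num : (0 : ℝ) < 3 / 2)).comp
        tendsto_natCast_atTop_atTop).const_mul Ct
      rw [mul_zero] at h
      exact h
    have h2 : Tendsto (fun q : ℕ ↦ Ce * (q : ℝ) ^ (-(1 / 4 : ℝ))) atTop (𝓝 0) := by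
      have h := ((tendsto_rpow_neg_atTop (by norm_num : (0 : ℝ) < 1 / 4)).comp
        tendsto_natCast_atTop_atTop).const_mul Ce
      rw [mul_zero] at h
      exact h
    exact ((tendsto_order.1 h1).2 ε' hε').and ((tendsto_order.1 h2).2 ε' hε')
  obtain ⟨q₃, Hq₃⟩ := Filter.eventually_atTop.1 hev
  refine ⟨q₃, fun q _ hq hq₃ ↦ ?_⟩
  obtain ⟨hW1, hE1⟩ := Hq₃ q hq₃
  have h₂ := abs_le.1 (Ht q hq)
  have h₁ := abs_le.1 (He q hq)
  constructor
  · linarith [h₂.2]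
  · linarith [h₁.1, h₂.1]

/-- **Kowalski–Michel–VanderKam's printed record «p₀ ≥ ¼», harmonic form, FROM THE TYPED FACTS.**
Print (p. 2, after Thm. 1.1): «The currently best bounds for these constants are p₀ ≥ 1/4 and
p₁ ≥ 7/16 (see [I-S, KM2])»; Thm. 1.6 is the harmonic-weight variant (weights `ω_f`, total mass `→ 1`,
`Σʰ_{S₂^±(q)} 1 ∼ ½` by (4)); p. 7 footnote 2 / §6 (35): the profile `P₀ = x²` gives `p₀ ≥ 1/4` as
`Δ → 1`. Kernel statement: the typed Props. 4.1/5.1 (`kmv2000_firstMomentPQ`, `kmv2000_secondMomentPQ`,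
`0 < Δ < 1`), Kowalski–Michel's Petersson fact and Lapid–Rallis non-negativity imply, for every
`t < ¼` and all large primes `q`, `Σʰ_{f ∈ H₂(q), L(½,f) ≠ 0} ω_f ≥ t` — indeed (stronger, with the
floor) via `primeLevelFamilyTwo_EStarFam_of_kmv_lt_half` at `p = t + ¼ < ½` of the even mass
`≥ ½ − o(1)`. Nothing here asserts the four facts; the natural-density version (Thm. 1.2, weight
removal [KM1 §3]) is NOT claimed.
[cite: KowalskiMichelVanderKam2000, p. 2 after Thm. 1.1 («p₀ ≥ 1/4»), Thm. 1.6 with (4), p. 7 footnote 2, §6 (35)] -/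
theorem harmonicNonvanishing_ge_of_kmv_lt_quarter
    (h₁ : kmv2000_firstMomentPQ) (h₂ : kmv2000_secondMomentPQ)
    (hP : KowalskiMichel2000.kowalskiMichel2000_petersson)
    (hLR : lapidRallis2003_theorem1_gl2Twist) {t : ℝ} (ht : t < 1 / 4) :
    ∃ q₀ : ℕ, ∀ (q : ℕ) [NeZero q], q.Prime → q₀ ≤ q →
      t ≤ harmonicSum q 2 (fun f ↦ if centralValue f ≠ 0 then (1 : ℝ) else 0) := by
  have hnn : ∀ (q : ℕ) [NeZero q],
      0 ≤ harmonicSum q 2 (fun f ↦ if centralValue f ≠ 0 then (1 : ℝ) else 0) := fun q _ ↦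
    harmonicSum_nonneg (by norm_num) fun f ↦ by split_ifs <;> norm_num
  by_cases ht0 : t < 0
  · exact ⟨0, fun q _ _ _ ↦ ht0.le.trans (hnn q)⟩
  push Not at ht0
  -- proportion `p = t + ¼ < ½` of the even mass, slack `ε = ¼ − t`
  set p : ℝ := t + 1 / 4 with hp_def
  have hp : p < 1 / 2 := by rw [hp_def]; linarith
  have hp0 : 0 ≤ p := by rw [hp_def]; linarith
  set ε : ℝ := 1 / 4 - t with hε_def
  have hε : 0 < ε := by rw [hε_def]; linarith
  obtain ⟨s₀, hs⟩ := primeLevelFamilyTwo_EStarFam_of_kmv_lt_half h₁ h₂ hP hLR hp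
  obtain ⟨q₃, Hq₃⟩ := evenMass_ge_eventually hP hε
  refine ⟨max ⌈s₀⌉₊ q₃, fun q _ hq hq₀ ↦ ?_⟩
  have hqs : s₀ ≤ (q : ℝ) :=
    le_trans (Nat.le_ceil _) (by exact_mod_cast le_trans (le_max_left _ _) hq₀)
  have hq₃ : q₃ ≤ q := le_trans (le_max_right _ _) hq₀
  obtain ⟨-, hEv⟩ := Hq₃ q hq hq₃
  set N : ℕ+ := ⟨q, hq.pos⟩ with hN_def
  have hE := hs N ⟨hq.squarefree, hq⟩ hqs
  change p * (iwaniecSarnakFamily 2).evenMass N ≤ (iwaniecSarnakFamily 2).goodMass 2 N at hE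
  rw [evenMass_iwaniecSarnakFamily, goodMass_iwaniecSarnakFamily] at hE
  -- the floor is positive at a prime level, so «good» ⇒ «non-vanishing»
  have hlog : 0 < (Real.log ((N : ℕ) : ℝ))⁻¹ ^ 2 := by
    have : (1 : ℝ) < ((N : ℕ) : ℝ) := by exact_mod_cast hq.one_lt
    have hl : 0 < Real.log ((N : ℕ) : ℝ) := Real.log_pos this
    positivity
  have hmono : harmonicSum (N : ℕ) 2
      (fun f ↦ if rootNumber f = 1 ∧ (Real.log ((N : ℕ) : ℝ))⁻¹ ^ 2 ≤ (centralValue f).re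
        then (1 : ℝ) else 0) ≤
      harmonicSum (N : ℕ) 2 (fun f ↦ if centralValue f ≠ 0 then (1 : ℝ) else 0) := by
    refine harmonicSum_mono (by norm_num) (finite_newforms0_holds (N : ℕ) 2) fun f _ ↦ ?_
    by_cases hg : rootNumber f = 1 ∧ (Real.log ((N : ℕ) : ℝ))⁻¹ ^ 2 ≤ (centralValue f).re
    · have hne : centralValue f ≠ 0 := fun h0 ↦ by
        have := hg.2
        rw [h0, Complex.zero_re] at this
        exact absurd this (not_le.2 hlog)
      rw [if_pos hg, if_pos hne]
    · rw [if_neg hg]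
      split_ifs <;> norm_num
  calc t ≤ p * (1 / 2 - ε) := by rw [hp_def, hε_def]; nlinarith [sq_nonneg (t - 1 / 4)]
    _ ≤ p * harmonicSum (N : ℕ) 2 (fun f ↦ if rootNumber f = 1 then (1 : ℝ) else 0) :=
        mul_le_mul_of_nonneg_left hEv hp0
    _ ≤ _ := hE
    _ ≤ _ := hmono

end Literature.NumberTheory.LFunctions.CentralValueFamilyHalfEdge
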